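import Summits.QuantumFields.BalabanUV.Beta.WilsonJetDivergence

/-!
# `GAN24.WilsonJetGaugeLeg` — the `(2,1)`-jet of the Wilson plaquette sum WITH ONE PURE-GAUGE FLUCTUATION LEG: the TABLE-leg cubic
# Ward identity `jet21_polar_grad` (MIDPOINT rule on the fluctuation co-leg, TIP rule on the background leg), ring level

HONEST FRAMING (cell charter, verbatim): «discharging `BetaPertH` makes Bałaban's UV stability UNCONDITIONAL — a real
constructive-QFT result; it is NOT the continuum limit and NOT the Clay problem.»  DERIVED cell leaf (pub-balaban, G-an2-4
formalisation swarm → CRUX TEAM (2), seat `b2b-balaban-gan24-formalise-leaf-02`, gen 45), toward the row owner's INTERFACE REQUEST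
G-an2-4 (2026-08-21T10:11Z: the four (CONV-C) slot letters hSrow ∕ hSdev ∕ hWrow ∕ hWdev at `JsB12Sym`) whose supplier of record for the
recursive first-order family is the owner's CONTACT-TERM ROUTE (`CT-ROUTE-v0.md`); step (CT-1) there is «the TABLE-leg cubic Ward
identity».  THIS FILE is that identity AT THE TREE'S OBJECT and at RING LEVEL: pure non-commutative word algebra and finite-lattice
bookkeeping over an3's `PlaquetteVertex` (Literature, [folklore]) — the twin of D1-leaf-05's `WilsonJetDivergence.jet21_grad` (pure gauge
on the BACKGROUND = index leg) for a pure gauge on a FLUCTUATION = table leg.  Nothing cited, no `[cite:]` tag, no `def … : Prop`, no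
estimate, no limit, 0 sorry; it instantiates NO binder of the β-function wall and discharges NO letter of (CONV-C).  NEVER «G-an2-4 closed»;
NOT hSrow, NOT D1, NOT `BetaPertH`, NOT continuum, NOT Clay.  «not in print; our bookkeeping».
HONEST DEPENDENCY (cell records, verbatim): «continuum YM on T⁴ ⇐ BetaPertH ∧ nine spine estimates (0/9 proved); BetaPertH ⇐ (D1) ∧
(D4) ∧ CAP+tail; G-an2-4 gates asym, D1 and NE2/3/4.»
ABSOLUTE RULE (cell charter, verbatim): «No internally-minted statement may enter as a cited fact. Every hypothesis is either
kernel-proved in this package or a verbatim quotation of a PUBLISHED theorem with page reference. The manuscript(s) under audit are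
NOT citable for their own disputed steps — they are the thing under adjudication; programme-internal (2001/route/tribunal) claims are
never citable.»

WHAT IS HERE ([folklore]; `τ` any `𝕜`-linear TRACIAL functional, `𝔸` any normed `𝕜`-algebra, `Λ` any finite abelian lattice with frame
`e : D → Λ`; `grad e λ` and `lcurl` are D1-leaf-05's ∕ an3's).
* §0 OBJECTS [our objects, asserting nothing]: `tipAdj e λ B x k := [λ(x + e_k), B_k(x)]` — conjugation of a bond field by the site field
  `λ` read at each bond's TIP; `midBr e λ W x k := [λ x + λ(x + e_k), W_k(x)]` — the DOUBLED midpoint conjugation (`½•midBr` is the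
  conjugation by the bond-midpoint average of `λ`).
* §1 RING LEVEL (per plaquette, `noncomm_ring`): `twistW_grad_left` — an3's transport sum `twistW` with a GRADIENT FLUCTUATION
  `grad e λ` against any background `B` telescopes to `lcurl (tipAdj e λ B) − [λ x, lcurl B]`; `twistW_add_left`; `plaqPairs_polar_grad` — the
  `W`-polarisation of the ordered-pair sum `SpinTable.plaqPairs` (B9 (3.10)'s `Σ_{b₁≺b₂}[A′(b₁),A′(b₂)]`) at `grad e λ` is
  `lcurl (midBr e λ W) − 2[λ x, lcurl W]`; `trace_br_cross` — cyclicity kills the two base-site terms together; and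
  **`jet21_polar_grad : jet21 𝕜 τ e (W + grad e λ) B − jet21 𝕜 τ e W B − jet21 𝕜 τ e (grad e λ) B
      = Σ_x Σ_μ Σ_ν ( ½•τ(lcurl B · lcurl (midBr e λ W)) + τ(lcurl W · lcurl (tipAdj e λ B)) )`** — the `W`-bilinear cross term of the
  summed `(2,1)`-jet (`PlaquetteVertex.jet21`, product chart `U_b = e^{W_b}e^{B_b}`, all ordered direction pairs) with ONE fluctuation leg
  the pure gauge `dλ`: the MIDPOINT rule `½(λ_x + λ_{x+e_k})` on the fluctuation co-leg (paired with `curl B`) and the TIP rule `λ_{x+e_k}`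
  on the background leg (paired with `curl W`).  Six lines over an3's normal form `PlaquetteVertex.jet21_eq`; no Baker–Campbell–Hausdorff,
  no analysis.
* §2 THE CHART CONTACT TERM (ring level, per oriented plaquette; the located INFO I-gan24leaf02-g45-1 of the cell journal made a kernel theorem):
  `six_smul_trace_cubic` — the third-order trace formula of the SINGLE chart, `6·τ(cubic l) = τ(Z³) + 3·τ(Z · commSum l)` (`Z = Σ l`; induction on
  the word, cyclicity); `two_twist_sub_polar_sub_chart`, `plaqPairs_sub_eq` (`noncomm_ring`); and
  **`trace_P21_plaq_eq_chart : τ(P21 𝕜 (plaq W B)) = (½•(τ cubic[W+B] − τ cubic[W−B]) − τ cubic[B]) + ½•τ(F_W · ([W₁,B₁] + [W₂,B₂] − [W₃,B₃] − [W₄,B₄]))`**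
  — the `(2,1)`-jet of the PRODUCT-chart word (an3's `P21 (plaq …)`: the object whose stripped table is `wilsonVertex₁` ∕ `wilsonA`) is the
  `(W², B¹)`-ray coefficient of the SINGLE-chart symmetric cubic of the merged letters `W_b + B_b` PLUS the contact term
  `½·τ(curl W · Σ_b ±[W_b, B_b])` (the `(2,1)`-shadow of `e^{W}e^{B} = e^{W + B + ½[W,B] + …}`; the `1∕12` double commutators are traceless);
  summed over a finite lattice: **`jet21_eq_chart`** (`jet21 = Σ (rays of the merged single-chart cubic) + ½•Σ τ(lcurl W · lcurl [W, B])`).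
READING (context for the consumer, asserted nowhere below).  By an3's `PlaquetteStencil.actionJet21_eq_wilsonVertex₁` the product-chart
`(2,1)`-jet IS the quadratic form of the first-order vertex `wilsonVertex₁`, whose colourless table on `ℤ^(d+1)` is an2's
`StepJetData.wilsonA`; so the three pure-gauge laws of THAT table are: INDEX leg — SITE rule (`WilsonJetDivergence.jet21_grad`, stripped in
`WilsonStencilDivergence.S₀A_grad`: `(ℓ q.1 − ℓ p.1)·Lc`); TABLE leg — midpoint on the co-leg + tip on the index (this file; stripping =
the sequel `WilsonStencilGaugeLeg`).  The owner's engine table (`gen13/srec_diff.py::wilson_cubic_table`: multilinear part of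
`exp(sP + tQ + rR)` on three distinct bonds) is the SINGLE-chart symmetric cubic, which carries the midpoint rule in all three slots; the two
differ by the chart contact term `½·τ(lcurl W · lcurl (x,k ↦ [W_k(x), B_k(x)]))` from `e^{W}e^{B} = e^{W + B + ½[W,B] + …}` (located INFO
I-gan24leaf02-g45-1 of the cell journal; per oriented plaquette this is §2's `trace_P21_plaq_eq_chart`).  PROVENANCE of the shape (not used in any proof): `τU(∂p)` is invariant
under `U_b ↦ g(b₋)U_b g(b₊)⁻¹`; composing with the chart change `e^{W}e^{B} ↦ e^{W′}e^{B′}` that moves a pure gauge from `B` to `W` turns the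
site rule of `jet21_grad` into midpoint + tip (`[m_λ, w] + ½[w, dλ] = [λ_site, w]` on a bond).
Sequels (not here): `WilsonStencilGaugeLeg` (coordinates `field t v`, `bondLetter`, colour stripping by the quaternion witness ⇒ the
finite-lattice entry law of `WilsonReflectionFrame.S₀A` with `dℓ` on a table leg), then the transfer to `wilsonA` on `ℤ^(d+1)`.
Provenance: seat b2b-balaban-gan24-formalise-leaf-02 gen 45 (prover-…-leaf-02-g45-0), 2026-08-21; over the files named above BY NAME.
-/

namespace Summit.QuantumFields.BalabanUV.Beta.GAN24.WilsonJetGaugeLeg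

open Finset
open scoped BigOperators
open Literature.MathematicalPhysics.QuantumFieldTheory.Balaban1983to89.Beta.SpinTable (br plaqPairs)
open Literature.MathematicalPhysics.QuantumFieldTheory.Balaban1983to89.Beta.PlaquetteVertex
open Summit.QuantumFields.BalabanUV.Beta.WilsonJetDivergence (grad adj lcurl_grad)

section Defs

/-- [our object] **TIP CONJUGATION** of a bond field by a site field: `(tipAdj e λ B)_k(x) = λ(x + e_k)·B_k(x) − B_k(x)·λ(x + e_k)` — the
letter `λ` read at the bond's TIP `x + e_k`.  A definition asserting nothing. -/
def tipAdj {Λ : Type*} [AddCommGroup Λ] {D : Type*} {𝔸 : Type*} [Ring 𝔸] (e : D → Λ) (lam : Λ → 𝔸) (B : Λ → D → 𝔸) :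
    Λ → D → 𝔸 :=
  fun x k => br (lam (x + e k)) (B x k)

/-- [our object] **DOUBLED MIDPOINT CONJUGATION** of a bond field by a site field: `(midBr e λ W)_k(x) = [λ x + λ(x + e_k), W_k(x)]`
(twice the conjugation by the bond-midpoint average `½(λ x + λ(x + e_k))`; doubled to stay at ring level).  A definition asserting
nothing. -/
def midBr {Λ : Type*} [AddCommGroup Λ] {D : Type*} {𝔸 : Type*} [Ring 𝔸] (e : D → Λ) (lam : Λ → 𝔸) (W : Λ → D → 𝔸) :
    Λ → D → 𝔸 :=
  fun x k => br (lam x + lam (x + e k)) (W x k)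

/-- [folklore] entries of `tipAdj`. -/
@[simp] theorem tipAdj_apply {Λ : Type*} [AddCommGroup Λ] {D : Type*} {𝔸 : Type*} [Ring 𝔸] (e : D → Λ) (lam : Λ → 𝔸)
    (B : Λ → D → 𝔸) (x : Λ) (k : D) : tipAdj e lam B x k = br (lam (x + e k)) (B x k) := rfl

/-- [folklore] entries of `midBr`. -/
@[simp] theorem midBr_apply {Λ : Type*} [AddCommGroup Λ] {D : Type*} {𝔸 : Type*} [Ring 𝔸] (e : D → Λ) (lam : Λ → 𝔸)
    (W : Λ → D → 𝔸) (x : Λ) (k : D) : midBr e lam W x k = br (lam x + lam (x + e k)) (W x k) := rfl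

end Defs

section Ring

variable (𝕜 : Type*) [RCLike 𝕜] {𝔸 : Type*} [NormedRing 𝔸] [NormedAlgebra 𝕜 𝔸]
variable {V : Type*} [AddCommGroup V] [Module 𝕜 V]
variable {Λ : Type*} [Fintype Λ] [AddCommGroup Λ] {D : Type*} [Fintype D]

omit [Fintype Λ] [Fintype D] [NormedAlgebra 𝕜 𝔸] in
/-- [folklore] **THE TRANSPORT SUM WITH A GRADIENT FLUCTUATION**: `twistW e (grad e λ) B = lcurl (tipAdj e λ B) − [λ x, lcurl B]` per
plaquette — the gradient letters telescope along the contour to `λ(tip of the bond) − λ(x)` against each background letter (twin of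
D1-leaf-05's `WilsonJetDivergence.twistW_grad`, roles of `W` and `B` exchanged). -/
theorem twistW_grad_left (e : D → Λ) (lam : Λ → 𝔸) (B : Λ → D → 𝔸) (x : Λ) (μ ν : D) :
    twistW e (grad e lam) B x μ ν = lcurl e (tipAdj e lam B) x μ ν - br (lam x) (lcurl e B x μ ν) := by
  have h : x + e ν + e μ = x + e μ + e ν := add_right_comm _ _ _
  simp only [twistW, lcurl, grad, tipAdj, br, h]
  noncomm_ring

omit [Fintype Λ] [Fintype D] [NormedAlgebra 𝕜 𝔸] in
/-- [folklore] an3's transport sum `twistW` is additive in the fluctuation. -/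
theorem twistW_add_left (e : D → Λ) (W W' B : Λ → D → 𝔸) (x : Λ) (μ ν : D) :
    twistW e (W + W') B x μ ν = twistW e W B x μ ν + twistW e W' B x μ ν := by
  simp only [twistW, br, Pi.add_apply]
  noncomm_ring

omit [Fintype Λ] [Fintype D] [NormedAlgebra 𝕜 𝔸] in
/-- [folklore] **THE ORDERED-PAIR SUM POLARISED AT A GRADIENT**: the `W`-bilinear cross term of `SpinTable.plaqPairs` (B9 (3.10)'s
`Σ_{b₁≺b₂}[A′(b₁), A′(b₂)]` over the boundary of `p_{μν}(x)`) between `W` and `grad e λ` is `lcurl (midBr e λ W) − 2·[λ x, lcurl W]` — the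
partial sums of the gradient letters around the contour are `λ(corner) − λ(x)`, and consecutive corners average to bond MIDPOINTS. -/
theorem plaqPairs_polar_grad (e : D → Λ) (W : Λ → D → 𝔸) (lam : Λ → 𝔸) (x : Λ) (μ ν : D) :
    plaqPairs ((W + grad e lam) x μ) ((W + grad e lam) x ν) ((W + grad e lam) (x + e ν) μ) ((W + grad e lam) (x + e μ) ν)
      - plaqPairs (W x μ) (W x ν) (W (x + e ν) μ) (W (x + e μ) ν)
      - plaqPairs (grad e lam x μ) (grad e lam x ν) (grad e lam (x + e ν) μ) (grad e lam (x + e μ) ν)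
    = lcurl e (midBr e lam W) x μ ν - 2 * br (lam x) (lcurl e W x μ ν) := by
  have h : x + e ν + e μ = x + e μ + e ν := add_right_comm _ _ _
  simp only [plaqPairs, lcurl, grad, midBr, br, Pi.add_apply, h]
  noncomm_ring

omit [Fintype Λ] [Fintype D] in
/-- [folklore] cyclicity kills the two base-site terms together: `τ(Y·[a, X]) + τ(X·[a, Y]) = 0`. -/
theorem trace_br_cross (τ : 𝔸 →ₗ[𝕜] V) (hτ : ∀ a b : 𝔸, τ (a * b) = τ (b * a)) (a X Y : 𝔸) :
    τ (Y * br a X) + τ (X * br a Y) = 0 := by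
  simp only [br, mul_sub, map_sub, ← mul_assoc]
  rw [hτ (Y * a) X, hτ (X * a) Y, ← mul_assoc, ← mul_assoc]
  abel

/-- [folklore] **THE `(2,1)`-JET WITH ONE PURE-GAUGE FLUCTUATION LEG (the TABLE-leg cubic Ward identity, ring level).**  For every
tracial `τ`, every background `B`, every fluctuation `W` and every site field `λ`:
`jet21 𝕜 τ e (W + grad e λ) B − jet21 𝕜 τ e W B − jet21 𝕜 τ e (grad e λ) B
   = Σ_x Σ_μ Σ_ν ( ½•τ((lcurl B)_{μν}(x) · (lcurl (midBr e λ W))_{μν}(x)) + τ((lcurl W)_{μν}(x) · (lcurl (tipAdj e λ B))_{μν}(x)) )`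
— the `W`-bilinear cross term of an3's summed `(2,1)`-jet with the pure gauge `grad e λ` on one fluctuation leg: MIDPOINT rule on the
fluctuation co-leg against `curl B`, TIP rule on the background leg against `curl W`.  From `PlaquetteVertex.jet21_eq` (spin + transport
normal form), `lcurl_grad` (the symmetric cubic and the gradient's own transport drop), `plaqPairs_polar_grad`, `twistW_grad_left`, and
`trace_br_cross` (the base-site terms `[λ x, ·]` cancel under the trace). -/
theorem jet21_polar_grad (τ : 𝔸 →ₗ[𝕜] V) (hτ : ∀ a b : 𝔸, τ (a * b) = τ (b * a)) (e : D → Λ) (W B : Λ → D → 𝔸)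
    (lam : Λ → 𝔸) :
    jet21 𝕜 τ e (W + grad e lam) B - jet21 𝕜 τ e W B - jet21 𝕜 τ e (grad e lam) B
      = ∑ x, ∑ μ, ∑ ν, ((2 : 𝕜)⁻¹ • τ (lcurl e B x μ ν * lcurl e (midBr e lam W) x μ ν)
          + τ (lcurl e W x μ ν * lcurl e (tipAdj e lam B) x μ ν)) := by
  rw [jet21_eq 𝕜 τ hτ, jet21_eq 𝕜 τ hτ, jet21_eq 𝕜 τ hτ, ← Finset.sum_sub_distrib, ← Finset.sum_sub_distrib]
  refine Finset.sum_congr rfl fun x _ => ?_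
  rw [← Finset.sum_sub_distrib, ← Finset.sum_sub_distrib]
  refine Finset.sum_congr rfl fun μ _ => ?_
  rw [← Finset.sum_sub_distrib, ← Finset.sum_sub_distrib]
  refine Finset.sum_congr rfl fun ν _ => ?_
  have hF : lcurl e (W + grad e lam) x μ ν = lcurl e W x μ ν := by rw [lcurl_add, lcurl_grad, add_zero]
  have hP := plaqPairs_polar_grad e W lam x μ ν
  rw [sub_sub, sub_eq_iff_eq_add] at hP
  have hc := trace_br_cross 𝕜 τ hτ (lam x) (lcurl e W x μ ν) (lcurl e B x μ ν)
  rw [hF, lcurl_grad, zero_mul, map_zero, add_zero, twistW_add_left, twistW_grad_left, hP]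
  simp only [mul_add, mul_sub, map_add, map_sub, smul_add, smul_sub, two_mul]
  have h2 : (2 : 𝕜)⁻¹ • (τ (lcurl e B x μ ν * br (lam x) (lcurl e W x μ ν)) + τ (lcurl e B x μ ν * br (lam x) (lcurl e W x μ ν)))
      = τ (lcurl e B x μ ν * br (lam x) (lcurl e W x μ ν)) := by
    rw [← two_smul 𝕜, smul_smul, inv_mul_cancel₀ (two_ne_zero' 𝕜), one_smul]
  rw [← h2]
  rw [← sub_eq_zero]
  have hc' : τ (lcurl e B x μ ν * br (lam x) (lcurl e W x μ ν)) = -τ (lcurl e W x μ ν * br (lam x) (lcurl e B x μ ν)) :=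
    eq_neg_of_add_eq_zero_left hc
  rw [hc']
  module

end Ring

/-! ## §2 Ring level: the chart contact term (product chart versus single chart, per oriented plaquette) -/

open Literature.MathematicalPhysics.QuantumFieldTheory.Balaban1983to89.Beta.TransportVertices (quad commSum two_smul_quad commSum_cons)
open Literature.MathematicalPhysics.QuantumFieldTheory.Balaban1983to89.Beta.WilsonVertex

section Chart

variable (𝕜 : Type*) [RCLike 𝕜] {𝔸 : Type*} [NormedRing 𝔸] [NormedAlgebra 𝕜 𝔸]
variable {V : Type*} [AddCommGroup V] [Module 𝕜 V]

/-- [folklore] **THE THIRD-ORDER TRACE FORMULA OF THE SINGLE CHART.**  For every word `l` and every tracial `τ`: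
`6·τ(cubic 𝕜 l) = τ(Z³) + 3·τ(Z · commSum l)`, `Z = Σ l` — the trace of the third-order term of `Π_j e^{l_j}` is the trace of the
third-order term of `exp(Z + ½·commSum l + (double commutators))` (the companion of an3's `two_smul_quad` ∕ `two_smul_trace_P21`; induction on
the word, the new letter's cross terms folded by cyclicity). -/
theorem six_smul_trace_cubic (τ : 𝔸 →ₗ[𝕜] V) (hτ : ∀ a b : 𝔸, τ (a * b) = τ (b * a)) (l : List 𝔸) :
    (6 : 𝕜) • τ (cubic 𝕜 l) = τ (l.sum * (l.sum * l.sum)) + (3 : 𝕜) • τ (l.sum * commSum l) := by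
  induction l with
  | nil => simp
  | cons b l ih =>
    have hq : (2 : 𝕜) • quad 𝕜 l = l.sum * l.sum + commSum l := two_smul_quad 𝕜 l
    set Z := l.sum with hZ
    set C := commSum l with hC
    rw [cubic_cons, List.sum_cons, commSum_cons, ← hZ, ← hC]
    -- cyclic identities
    have c1 : τ (b * (Z * b)) = τ (b * (b * Z)) := by rw [← mul_assoc, hτ (b * Z) b]
    have c2 : τ (Z * (b * b)) = τ (b * (b * Z)) := by rw [hτ Z (b * b), mul_assoc]
    have c3 : τ (Z * (b * Z)) = τ (b * (Z * Z)) := by rw [hτ Z (b * Z), mul_assoc]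
    have c4 : τ (Z * (Z * b)) = τ (b * (Z * Z)) := by rw [← mul_assoc, hτ (Z * Z) b]
    -- 6•τ(b * quad l) = 3•τ(b*(Z*Z)) + 3•τ(b*C)
    have hbq : (6 : 𝕜) • τ (b * quad 𝕜 l) = (3 : 𝕜) • (τ (b * (Z * Z)) + τ (b * C)) := by
      have : (6 : 𝕜) • τ (b * quad 𝕜 l) = (3 : 𝕜) • τ (b * ((2 : 𝕜) • quad 𝕜 l)) := by
        rw [mul_smul_comm, map_smul, smul_smul]; norm_num
      rw [this, hq, mul_add, map_add]
    have e1 : (6 : 𝕜) • τ ((2 : 𝕜)⁻¹ • (b * b) * Z) = (3 : 𝕜) • τ (b * (b * Z)) := by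
      rw [smul_mul_assoc, map_smul, smul_smul, mul_assoc]; norm_num
    have e2 : (6 : 𝕜) • τ ((6 : 𝕜)⁻¹ • (b * b * b)) = τ (b * (b * b)) := by
      rw [map_smul, smul_smul, mul_inv_cancel₀ (by norm_num : (6 : 𝕜) ≠ 0), one_smul, mul_assoc]
    simp only [map_add, smul_add, ih, hbq, e1, e2, mul_add, add_mul, mul_sub, map_sub, c1, c2, c3, c4]
    module


/-- [folklore] cyclic normal form of the three `(W², B¹)` monomials: `τ(X·(Y·X)) = τ(X·(X·Y))`. -/
theorem trace_XYX (τ : 𝔸 →ₗ[𝕜] V) (hτ : ∀ a b : 𝔸, τ (a * b) = τ (b * a)) (X Y : 𝔸) :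
    τ (X * (Y * X)) = τ (X * (X * Y)) := by rw [← mul_assoc, hτ (X * Y) X]

/-- [folklore] cyclic normal form: `τ(Y·(X·X)) = τ(X·(X·Y))`. -/
theorem trace_YXX (τ : 𝔸 →ₗ[𝕜] V) (hτ : ∀ a b : 𝔸, τ (a * b) = τ (b * a)) (X Y : 𝔸) :
    τ (Y * (X * X)) = τ (X * (X * Y)) := by
  rw [hτ Y (X * X), mul_assoc]

variable (W₁ W₂ W₃ W₄ B₁ B₂ B₃ B₄ : 𝔸)

omit [NormedAlgebra 𝕜 𝔸] in
/-- [folklore] **THE KEY RING IDENTITY**: twice an3's transport sum of the product-chart plaquette word, minus the `W`–`B` polarisation of the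
ordered-pair sum of the MERGED (single-chart) word, minus the signed sum `G` of the bondwise chart commutators `[W_b, B_b]`, is the commutator
`[F_B, F_W]` of the two curls (which the trace against `F_W` kills). -/
theorem two_twist_sub_polar_sub_chart :
    2 * ((B₁ * W₂ - W₂ * B₁) - ((B₁ + B₂ - B₃) * W₃ - W₃ * (B₁ + B₂ - B₃)) - ((B₁ + B₂ - B₃ - B₄) * W₄ - W₄ * (B₁ + B₂ - B₃ - B₄)))
      - (plaqPairs (W₁ + B₁) (W₄ + B₄) (W₃ + B₃) (W₂ + B₂) - plaqPairs W₁ W₄ W₃ W₂ - plaqPairs B₁ B₄ B₃ B₂)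
      - (br W₁ B₁ + br W₂ B₂ - br W₃ B₃ - br W₄ B₄)
    = (B₁ + B₂ - B₃ - B₄) * (W₁ + W₂ - W₃ - W₄) - (W₁ + W₂ - W₃ - W₄) * (B₁ + B₂ - B₃ - B₄) := by
  simp only [plaqPairs, br]
  noncomm_ring

omit [NormedAlgebra 𝕜 𝔸] in
/-- [folklore] the ordered-pair sum of the merged word at `W − B` from the one at `W + B` (it is a quadratic polynomial). -/
theorem plaqPairs_sub_eq :
    plaqPairs (W₁ - B₁) (W₄ - B₄) (W₃ - B₃) (W₂ - B₂) =
      2 * (plaqPairs W₁ W₄ W₃ W₂ + plaqPairs B₁ B₄ B₃ B₂) - plaqPairs (W₁ + B₁) (W₄ + B₄) (W₃ + B₃) (W₂ + B₂) := by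
  simp only [plaqPairs, br]
  noncomm_ring

/-- [folklore] **THE CHART CONTACT TERM (per oriented plaquette).**  For every tracial `τ`: the `(2,1)`-jet of the PRODUCT-chart plaquette word
`e^{W₁}e^{B₁}e^{W₂}e^{B₂}e^{−B₃}e^{−W₃}e^{−B₄}e^{−W₄}` (an3's `P21 (plaq …)`, whose colour-stripped table is `wilsonVertex₁` ∕ an2's `wilsonA`) equals
the `(W², B¹)`-ray coefficient of the SINGLE-chart symmetric cubic `cubic [W₁+B₁, W₂+B₂, −(W₃+B₃), −(W₄+B₄)]` (`U_b = e^{W_b + B_b}`) PLUS the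
chart contact term `½·τ(F_W · ([W₁,B₁] + [W₂,B₂] − [W₃,B₃] − [W₄,B₄]))` — the trace of the curl of `W` against the signed boundary sum of the
bondwise commutators, i.e. the `(2,1)`-shadow of `e^{W}e^{B} = e^{W + B + ½[W,B] + …}` (the `1∕12` double commutators are traceless). -/
theorem trace_P21_plaq_eq_chart (τ : 𝔸 →ₗ[𝕜] V) (hτ : ∀ a b : 𝔸, τ (a * b) = τ (b * a)) :
    τ (P21 𝕜 (plaq W₁ W₂ W₃ W₄ B₁ B₂ B₃ B₄)) =
      ((2 : 𝕜)⁻¹ • (τ (cubic 𝕜 [W₁ + B₁, W₂ + B₂, -(W₃ + B₃), -(W₄ + B₄)])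
          - τ (cubic 𝕜 [W₁ - B₁, W₂ - B₂, -(W₃ - B₃), -(W₄ - B₄)]))
        - τ (cubic 𝕜 [B₁, B₂, -B₃, -B₄]))
      + (2 : 𝕜)⁻¹ • τ ((W₁ + W₂ - W₃ - W₄) * (br W₁ B₁ + br W₂ B₂ - br W₃ B₃ - br W₄ B₄)) := by
  -- multiply by 6 and use the normal forms
  have h6 : (6 : 𝕜) ≠ 0 := by norm_num
  apply smul_right_injective V h6
  have hP := trace_P21_plaq 𝕜 W₁ W₂ W₃ W₄ B₁ B₂ B₃ B₄ τ hτ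
  have hcp := six_smul_trace_cubic 𝕜 τ hτ [W₁ + B₁, W₂ + B₂, -(W₃ + B₃), -(W₄ + B₄)]
  have hcm := six_smul_trace_cubic 𝕜 τ hτ [W₁ - B₁, W₂ - B₂, -(W₃ - B₃), -(W₄ - B₄)]
  have hcB := six_smul_trace_cubic 𝕜 τ hτ [B₁, B₂, -B₃, -B₄]
  rw [commSum_wpart_plaq, sum_four_signed] at hcp hcm hcB
  -- names
  set fW := W₁ + W₂ - W₃ - W₄ with hfW
  set fB := B₁ + B₂ - B₃ - B₄ with hfB
  set P := plaqPairs W₁ W₄ W₃ W₂ with hPdef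
  set Q := plaqPairs B₁ B₄ B₃ B₂ with hQdef
  set Rp := plaqPairs (W₁ + B₁) (W₄ + B₄) (W₃ + B₃) (W₂ + B₂) with hRp
  set T := (B₁ * W₂ - W₂ * B₁) - ((B₁ + B₂ - B₃) * W₃ - W₃ * (B₁ + B₂ - B₃)) - ((B₁ + B₂ - B₃ - B₄) * W₄ - W₄ * (B₁ + B₂ - B₃ - B₄))
    with hT
  set G := br W₁ B₁ + br W₂ B₂ - br W₃ B₃ - br W₄ B₄ with hG
  have eFp : W₁ + B₁ + (W₂ + B₂) - (W₃ + B₃) - (W₄ + B₄) = fW + fB := by rw [hfW, hfB]; abel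
  have eFm : W₁ - B₁ + (W₂ - B₂) - (W₃ - B₃) - (W₄ - B₄) = fW - fB := by rw [hfW, hfB]; abel
  have eRm : plaqPairs (W₁ - B₁) (W₄ - B₄) (W₃ - B₃) (W₂ - B₂) = 2 * (P + Q) - Rp := plaqPairs_sub_eq W₁ W₂ W₃ W₄ B₁ B₂ B₃ B₄
  have eKey : Rp = 2 * T + P + Q - G - (fB * fW - fW * fB) := by
    have h := two_twist_sub_polar_sub_chart W₁ W₂ W₃ W₄ B₁ B₂ B₃ B₄
    rw [← hT, ← hRp, ← hPdef, ← hQdef, ← hG, ← hfW, ← hfB] at h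
    rw [← h]; noncomm_ring
  rw [eFp] at hcp
  rw [eFm, eRm] at hcm
  rw [eKey] at hcp hcm
  -- cyclic normal forms of the cubic monomials that occur
  have c1 := trace_XYX 𝕜 τ hτ fW fB
  have c2 := trace_YXX 𝕜 τ hτ fW fB
  have c3 := trace_XYX 𝕜 τ hτ fB fW
  have c4 := trace_YXX 𝕜 τ hτ fB fW
  have c5 : τ (fW * (fB * fW - fW * fB)) = 0 := by rw [mul_sub, map_sub, c1, sub_self]
  -- assemble
  rw [hP]
  simp only [smul_add, smul_sub, smul_smul]
  have e62 : (6 : 𝕜) * (2 : 𝕜)⁻¹ = 3 := by norm_num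
  rw [e62]
  have e26 : (2 : 𝕜)⁻¹ * (6 : 𝕜) = 3 := by norm_num
  have hcp' : (3 : 𝕜) • τ (cubic 𝕜 [W₁ + B₁, W₂ + B₂, -(W₃ + B₃), -(W₄ + B₄)]) =
      (2 : 𝕜)⁻¹ • ((6 : 𝕜) • τ (cubic 𝕜 [W₁ + B₁, W₂ + B₂, -(W₃ + B₃), -(W₄ + B₄)])) := by
    rw [smul_smul, e26]
  have hcm' : (3 : 𝕜) • τ (cubic 𝕜 [W₁ - B₁, W₂ - B₂, -(W₃ - B₃), -(W₄ - B₄)]) =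
      (2 : 𝕜)⁻¹ • ((6 : 𝕜) • τ (cubic 𝕜 [W₁ - B₁, W₂ - B₂, -(W₃ - B₃), -(W₄ - B₄)])) := by
    rw [smul_smul, e26]
  rw [hcp', hcm', hcp, hcm, hcB]
  simp only [mul_add, add_mul, mul_sub, sub_mul, map_add, map_sub, smul_add, smul_sub, c1, c2, c3, c4, two_mul]
  module


variable {Λ : Type*} [Fintype Λ] [AddCommGroup Λ] {D : Type*} [Fintype D]

/-- [folklore] **THE CHART CONTACT TERM, SUMMED OVER THE LATTICE**: for every tracial `τ`, every fluctuation `W` and background `B` on a finite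
lattice, an3's summed `(2,1)`-jet of the PRODUCT chart equals the plaquette sum of the `(W², B¹)`-ray coefficients of the SINGLE-chart symmetric
cubic of the merged letters `W + B`, PLUS `½ · Σ_x Σ_μ Σ_ν τ((lcurl W)_{μν}(x) · (lcurl [W, B])_{μν}(x))`, `[W, B]_k(x) := [W_k(x), B_k(x)]` bondwise. -/
theorem jet21_eq_chart (τ : 𝔸 →ₗ[𝕜] V) (hτ : ∀ a b : 𝔸, τ (a * b) = τ (b * a)) (e : D → Λ) (W B : Λ → D → 𝔸) :
    jet21 𝕜 τ e W B =
      (∑ x, ∑ μ, ∑ ν,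
        ((2 : 𝕜)⁻¹ • (τ (cubic 𝕜 [(W + B) x μ, (W + B) (x + e μ) ν, -((W + B) (x + e ν) μ), -((W + B) x ν)])
            - τ (cubic 𝕜 [(W - B) x μ, (W - B) (x + e μ) ν, -((W - B) (x + e ν) μ), -((W - B) x ν)]))
          - τ (cubic 𝕜 [B x μ, B (x + e μ) ν, -(B (x + e ν) μ), -(B x ν)])))
      + (2 : 𝕜)⁻¹ • ∑ x, ∑ μ, ∑ ν, τ (lcurl e W x μ ν * lcurl e (fun y k => br (W y k) (B y k)) x μ ν) := by
  unfold jet21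
  rw [Finset.smul_sum, ← Finset.sum_add_distrib]
  refine Finset.sum_congr rfl fun x _ => ?_
  rw [Finset.smul_sum, ← Finset.sum_add_distrib]
  refine Finset.sum_congr rfl fun μ _ => ?_
  rw [Finset.smul_sum, ← Finset.sum_add_distrib]
  refine Finset.sum_congr rfl fun ν _ => ?_
  have h := trace_P21_plaq_eq_chart 𝕜 (W x μ) (W (x + e μ) ν) (W (x + e ν) μ) (W x ν) (B x μ) (B (x + e μ) ν) (B (x + e ν) μ) (B x ν) τ hτ
  rw [signed_sum_eq_lcurl e W x μ ν, signed_sum_eq_lcurl e (fun y k => br (W y k) (B y k)) x μ ν] at h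
  simp only [Pi.add_apply, Pi.sub_apply, neg_add, neg_sub] at h ⊢
  exact h

end Chart

end Summit.QuantumFields.BalabanUV.Beta.GAN24.WilsonJetGaugeLeg
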